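import Mathlib
import HarnessLib

/-!
# Hermitian matrix polynomials whose characteristic polynomial has small total degree are linear

Topic `Literature/AlgebraicGeometry/DeterminantalHypersurfaces`. A lemma of C. Hanselka, printed
with proof as **Lemma 4.3** of A. Grinshpan, D. S. Kaliuzhnyi-Verbovetskyi, V. Vinnikov,
H. J. Woerdeman, *Stable and real-zero polynomials in two variables*, Multidimens. Syst. Signal
Process. 27 (2016) 1–26 (arXiv:1306.6655, §4):

"Let `M` be a `d × d` matrix-valued polynomial in one variable with Hermitian coefficients, and
assume that the polynomial `det(tI_d − M(s))` has total degree at most `d`; then `M` is linear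
(i.e., `deg M ≤ 1`)."

It is the last step of every construction of a (Hermitian or real symmetric) determinantal
representation `p(x₁,x₂) = det(I + x₁A₁ + x₂A₂)` of a real-zero polynomial through a
factorisation of a positive semidefinite matrix polynomial (ibid., both proofs of Thm. 4.1; the
route to the Helton–Vinnikov theorem / Lax conjecture,
`Literature.AlgebraicGeometry.DeterminantalHypersurfaces.LewisParriloRamana2005_laxConjecture`,
that avoids theta functions): one first produces a Hermitian matrix POLYNOMIAL `M(s)` with
`det(tI − M(s)) = p̌(t,s)` and then needs `M` to be a pencil.

## Proof

The printed proof reads the sums of principal minors off the coefficients of the characteristic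
polynomial. We formalise an equivalent coefficient extraction that only needs the top coefficient
of a determinant (`coeff_det_of_natDegree_le`): if `K = deg M ≥ 2` with top coefficient
`B ≠ 0`, substitute `t ↦ τ s^K` (`τ` a scalar) in `det(tI − M(s))`; the coefficient of `s^{Kd}`
is `det(τI − B)` on the matrix side and `τ^d` on the polynomial side (a monomial `t^k s^j` with
`k + j ≤ d` contributes to `s^{Kk+j}`, and `Kk + j = Kd` forces `k = d`, `j = 0` when `K ≥ 2`).
Hence `charpoly B = X^d`, `B` is nilpotent (Cayley–Hamilton) and Hermitian, so `B = 0`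
(`eq_zero_of_isHermitian_of_pow_eq_zero`), a contradiction.

## Contents

* `coeff_det_of_natDegree_le` — top coefficient of `det N` for a polynomial matrix with entries
  of degree `≤ K` [folklore];
* `eq_zero_of_isHermitian_of_pow_eq_zero` — a nilpotent Hermitian matrix over `ℝ`/`ℂ` vanishes
  [folklore];
* `natDegree_le_one_of_isHermitian_coeff` — the lemma (Hermitian coefficients, `RCLike` scalars);
* `natDegree_le_one_of_isSymm` — the real symmetric case (`Mᵀ = M` over `ℝ[s]`).

"Total degree at most `d`" of `det(tI − M(s)) = M.charpoly ∈ 𝕜[s][t]` is rendered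
coefficientwise: the coefficient of `t^k s^j` vanishes whenever `k + j > d`.

## References

* [GrinshpanEtAl2014] A. Grinshpan, D. S. Kaliuzhnyi-Verbovetskyi, V. Vinnikov, H. J. Woerdeman,
  Stable and real-zero polynomials in two variables, Multidimens. Syst. Signal Process. 27 (2016)
  1–26, doi:10.1007/s11045-014-0286-3 (arXiv:1306.6655): Lemma 4.3 (attributed to C. Hanselka),
  Thm. 4.1.
-/

noncomputable section

open Polynomial Matrix

namespace Literature.AlgebraicGeometry.DeterminantalHypersurfaces

variable {R : Type*} [CommRing R] {n : Type*} [Fintype n] [DecidableEq n]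

/-- **Top coefficient of a determinant of polynomials.** If every entry of `N ∈ Mₙ(R[X])` has
degree `≤ K`, then the coefficient of `X^{K·|n|}` in `det N` is the determinant of the matrix of
`X^K`-coefficients (the generalisation of Mathlib's `Polynomial.coeff_det_X_add_C_card` from
pencils to degree `K`). [folklore] -/
theorem coeff_det_of_natDegree_le (N : Matrix n n R[X]) (K : ℕ)
    (hN : ∀ i j, (N i j).natDegree ≤ K) :
    (det N).coeff (Fintype.card n * K) = det (N.map fun p => p.coeff K) := by
  rw [det_apply, det_apply, finsetSum_coeff]
  refine Finset.sum_congr rfl fun g _ => ?_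
  rw [coeff_smul, ← Finset.card_univ, coeff_prod_of_natDegree_le (s := Finset.univ)
    (f := fun p => N (g p) p) (n := K) (h := fun p _ => hN (g p) p)]
  rfl

section Hermitian

open scoped ComplexOrder

variable {𝕜 : Type*} [RCLike 𝕜]

/-- A Hermitian matrix over `ℝ` or `ℂ` with a vanishing power is zero (a nilpotent self-adjoint
matrix vanishes: `A^{2m} = (A^m)ᴴ A^m = 0 ⇒ A^m = 0`). [folklore] -/
theorem eq_zero_of_isHermitian_of_pow_eq_zero {A : Matrix n n 𝕜} (hA : A.IsHermitian) {m : ℕ}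
    (h : A ^ m = 0) : A = 0 := by
  -- first for powers of two
  have key : ∀ (k : ℕ) (B : Matrix n n 𝕜), B.IsHermitian → B ^ (2 ^ k) = 0 → B = 0 := by
    intro k
    induction k with
    | zero => intro B _ hB; simpa using hB
    | succ k ih =>
      intro B hB hBk
      apply ih B hB
      have h2 : B ^ (2 ^ (k + 1)) = (B ^ (2 ^ k))ᴴ * B ^ (2 ^ k) := by
        rw [(hB.pow (2 ^ k)).eq, ← pow_add, ← two_mul, ← pow_succ']
      rw [h2] at hBk
      exact Matrix.conjTranspose_mul_self_eq_zero.mp hBk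
  refine key m A hA ?_
  have hm : m ≤ 2 ^ m := (Nat.lt_two_pow_self).le
  rw [← Nat.add_sub_cancel' hm, pow_add, h, zero_mul]

/-- **Hanselka's lemma** ([GrinshpanEtAl2014, Lemma 4.3]): let `M ∈ Mₙ(𝕜[s])` (`𝕜 = ℝ` or `ℂ`) be a
matrix polynomial with Hermitian coefficients such that `det(tI − M(s))` — the characteristic
polynomial of `M` over `𝕜[s]` — has total degree at most `|n|` in `(t, s)`, i.e. its coefficient
of `t^k s^j` vanishes whenever `k + j > |n|`. Then `M` is linear: every entry has degree `≤ 1`.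
[cite: GrinshpanEtAl2014, Lemma 4.3] -/
theorem natDegree_le_one_of_isHermitian_coeff (M : Matrix n n 𝕜[X])
    (hM : ∀ k : ℕ, (M.map fun p => p.coeff k).IsHermitian)
    (hdeg : ∀ k j : ℕ, Fintype.card n < k + j → (M.charpoly.coeff k).coeff j = 0) (i j : n) :
    (M i j).natDegree ≤ 1 := by
  classical
  -- `K` = the degree of `M` (attained at the entry `ij₀`), `B` = its top coefficient
  obtain ⟨ij₀, -, hij₀⟩ := Finset.exists_mem_eq_sup (Finset.univ : Finset (n × n))
    ⟨(i, j), Finset.mem_univ _⟩ (fun ij : n × n => (M ij.1 ij.2).natDegree)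
  obtain ⟨K, hK⟩ : ∃ K : ℕ, (M ij₀.1 ij₀.2).natDegree = K := ⟨_, rfl⟩
  have hle : ∀ i' j', (M i' j').natDegree ≤ K := fun i' j' => by
    have h := Finset.le_sup (f := fun ij : n × n => (M ij.1 ij.2).natDegree)
      (Finset.mem_univ (i', j'))
    rw [hij₀] at h
    exact h.trans_eq hK
  by_contra hij
  have hK2 : 2 ≤ K := (Nat.succ_le_of_lt (not_le.mp hij)).trans (hle i j)
  set d : ℕ := Fintype.card n with hd
  set B : Matrix n n 𝕜 := M.map fun p => p.coeff K with hB
  -- Step 1: `det(τI − B) = τ^d` for every scalar `τ` (substitute `t ↦ τ s^K`).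
  have hdet : ∀ τ : 𝕜, (Matrix.scalar n τ - B).det = τ ^ d := by
    intro τ
    set t : 𝕜[X] := C τ * X ^ K with ht
    have htdeg : t.natDegree ≤ K := natDegree_C_mul_X_pow_le τ K
    -- matrix side
    have hN : ∀ i' j', ((Matrix.scalar n t - M) i' j').natDegree ≤ K := by
      intro i' j'
      refine (natDegree_sub_le _ _).trans (max_le ?_ (hle i' j'))
      rw [scalar_apply]
      by_cases h : i' = j'
      · subst h
        simpa [diagonal_apply_eq] using htdeg
      · simp [diagonal_apply_ne _ h]
    have hmap : (Matrix.scalar n t - M).map (fun p => p.coeff K) = Matrix.scalar n τ - B := by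
      ext i' j'
      simp only [map_apply, Matrix.sub_apply, coeff_sub, hB, scalar_apply]
      by_cases h : i' = j'
      · subst h
        simp [diagonal_apply_eq, ht, coeff_C_mul, coeff_X_pow]
      · simp [diagonal_apply_ne _ h]
    have h1 : (M.charpoly.eval t).coeff (d * K) = (Matrix.scalar n τ - B).det := by
      rw [eval_charpoly, ← hmap, hd]
      exact coeff_det_of_natDegree_le _ K hN
    -- polynomial side
    have h2 : (M.charpoly.eval t).coeff (d * K) = τ ^ d := by
      have hnat : M.charpoly.natDegree = d := by rw [hd]; exact charpoly_natDegree_eq_dim M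
      rw [eval_eq_sum_range, hnat, finsetSum_coeff, Finset.sum_eq_single d]
      · have hc : M.charpoly.coeff d = 1 := by
          have := (charpoly_monic M).coeff_natDegree
          rwa [hnat] at this
        rw [hc, one_mul, ht, mul_pow, ← C_pow, ← pow_mul, coeff_C_mul, mul_comm K d,
          coeff_X_pow_self, mul_one]
      · intro k hk hkd
        have hk' : k < d := lt_of_le_of_ne (Nat.lt_succ_iff.mp (Finset.mem_range.mp hk)) hkd
        rw [ht, mul_pow, ← C_pow, ← pow_mul, ← mul_assoc, coeff_mul_X_pow', coeff_mul_C]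
        split_ifs with hle'
        · have hz : (M.charpoly.coeff k).coeff (d * K - K * k) = 0 := by
            apply hdeg
            have heq : d * K - K * k = K * (d - k) := by
              rw [Nat.mul_sub, mul_comm K d]
            rw [heq]
            have h3 : d - k < K * (d - k) := by
              calc d - k = 1 * (d - k) := (one_mul _).symm
                _ < K * (d - k) := Nat.mul_lt_mul_of_lt_of_le (by omega) le_rfl (by omega)
            omega
          rw [hz, zero_mul]
        · rfl
      · intro hd'
        exact absurd (Finset.mem_range.mpr (Nat.lt_succ_self d)) hd'
    rw [← h1, h2]
  -- Step 2: `charpoly B = X^d`, so `B` is nilpotent and Hermitian, hence zero.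
  have hchar : B.charpoly = X ^ d := by
    apply Polynomial.eq_of_infinite_eval_eq
    apply Set.infinite_univ.mono
    intro τ _
    simp only [Set.mem_setOf_eq, eval_charpoly, hdet, eval_pow, eval_X]
  have hnil : B ^ d = 0 := by
    have := aeval_self_charpoly B
    rwa [hchar, map_pow, aeval_X] at this
  have hB0 : B = 0 := eq_zero_of_isHermitian_of_pow_eq_zero (hM K) hnil
  -- Step 3: contradiction — the top coefficient of the entry `ij₀` of degree `K ≥ 2` vanishes.
  have hcoeff : (M ij₀.1 ij₀.2).coeff K = 0 := by
    have := congr_fun (congr_fun hB0 ij₀.1) ij₀.2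
    simpa [hB] using this
  have hne : M ij₀.1 ij₀.2 ≠ 0 := by
    intro h0
    rw [h0, natDegree_zero] at hK
    omega
  have hlc : (M ij₀.1 ij₀.2).leadingCoeff = 0 := by
    rw [leadingCoeff, hK, hcoeff]
  exact hne (leadingCoeff_eq_zero.mp hlc)

/-- **Hanselka's lemma, real symmetric form** ([GrinshpanEtAl2014, Lemma 4.3] for real symmetric
coefficients): a symmetric matrix `M ∈ Mₙ(ℝ[s])`, `Mᵀ = M`, whose characteristic polynomial
`det(tI − M(s))` has total degree at most `|n|` in `(t, s)` is a linear pencil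
`M(s) = M₀ + s M₁`. [cite: GrinshpanEtAl2014, Lemma 4.3] -/
theorem natDegree_le_one_of_isSymm (M : Matrix n n ℝ[X]) (hM : M.IsSymm)
    (hdeg : ∀ k j : ℕ, Fintype.card n < k + j → (M.charpoly.coeff k).coeff j = 0) (i j : n) :
    (M i j).natDegree ≤ 1 := by
  refine natDegree_le_one_of_isHermitian_coeff M (fun k => ?_) hdeg i j
  rw [IsHermitian, conjTranspose_eq_transpose_of_trivial, ← transpose_map, hM.eq]

end Hermitian

end Literature.AlgebraicGeometry.DeterminantalHypersurfaces
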